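import Summits.ValiantsHypothesis.ValiantsHypothesis.Theses.ProjectionRigidity
import Summits.ValiantsHypothesis.ValiantsHypothesis.Theorems.GrenetRigidityOptimalUniqueRefutation
import Literature.Computability.AlgebraicComplexity.GrenetProjection

/-!
# Disproof of `ProjOptimalUnique` (stmt-ValiantsHypothesis-16001) — findings of the crux disprover, cycle 1

Crux (route `ProjectionRigidity`, rank 2): for `n ≥ 3`, any two PURE projections `A, B` of `DET`
(entries `X v` / `C c`) of the optimal size `m = pdc(per_n)` with `det = per_n` satisfy
`B = P·A(γx)·Q` or `B = P·A(γx)ᵀ·Q`, `P, Q ∈ GL_m(ℂ)`, `γ ∈ permSymmetrySubst ℂ n`.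
Only `n = 3` is certifiable (`pdc(per₃) = 7`, tree `detProjectionComplexity_perPoly_three`; the
level-3 instance IS `ProjOptimalUniqueThree`, tree `projOptimalUniqueThree_of_projOptimalUnique`).

VERDICT OF THE CYCLE: **KILLED at `n = 3`** — `ProjOptimalUnique` is FALSE.  The decisive witness is
the PURIFIED single-syzygy Koszul twist `K = P·G·(1 + D)·Q` (`D` = column `v₀ ← (X10, −X00, 0)ᵀ`,
`P, Q ∈ SL₇(ℤ)`), a pure `{0, ±1} ∪ X` projection of `DET₇` with `det K = per₃`, landed by the
disprover seat of the sibling crux stmt-16002 as `Theorems/ProjOptimalUnique/Negative/PurifiedTwist.lean`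
(`exists_grenet_purifiedTwist`) and re-verified here in exact arithmetic (`compute/verifyK.py`:
`det K = per₃`, rank profile `1⁴2⁵` vs `1⁶2³`, `K ≁ G` under `GL₇ × GL₇`, no dead cell).  The refutation
of THIS crux landed as `Theorems/ProjectionRigidityProjOptimalUniqueRefutation.lean`
(`not_ProjOptimalUnique`, same sibling seat, commit 616b35d018ac, item closed 10:58Z; class
refuted-SUBSTANTIVE); this seat's independent second proof (`Refutation.lean` in the session folder,
rc 0: transport along `pdc(per₃) = 7` + six-versus-four rank-one variables under the BIJECTIVE monomial
row map of `γ`, a different counting argument than the landed pigeonhole on private cells) is attached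
to the item as evidence together with the exact re-verification.  What this file adds: WHY the
lead's toric candidate `T` (column-`u₀` twist) could not be purified while the column-`v₀` twist can
(§B), the two load-bearing relaxations (§A, landed), the taut size-8 orbit (§C), and the structural
picture (§D: every affine representation of `per₃` is a polynomial-gauge twist of Grenet, so the whole
question was always "which twists purify").

INDEX
* §A  load-bearing hypotheses (both LANDED as `Theorems/ProjOptimalUnique/Negative/*`):
  - `projOptimalUnique_false_without_pure`      — affine instead of pure: FALSE (p154300; the
    relocated def is `Literature.Uncategorized.ProjOptimalUniqueWithoutPure`, p154298).
  - `projOptimalUnique_false_without_optimality` — every size `m` instead of `m = pdc`: FALSE at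
    `m = 8 = pdc + 1` (p154831), binary witnesses.
* §B  the TORIC strengthening is false at the optimal size 7: `toricTwist` (`T = G·(1 + D)`, the
  one-column Koszul twist of Grenet's `G` by the third basic syzygy) is a SIGNED projection with
  `det T = per₃` (proved here) whose `X(1,0)`- and `X(2,0)`-coefficient matrices have rank 2 (proved
  here: `G` has six rank-one variables, `T` four), hence `T ∉ GL₇·G(γx)·GL₇ ∪ ᵀ` — formal proof of the
  non-equivalence is the next negative lemma (`toricTwist_not_detReprEquivalent`, sorried below with
  the exact plan).  `T` is NOT PURIFIABLE: no `P·T_c·Q` (`T_c = G + c·(X(2,0)E₂₁ − X(1,0)E₃₁)`, all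
  `c`, hence all torus relabellings) is pure — hand proof in the docstring; so `T` does not refute the
  crux, exactly as the strategist predicted.
* §C  why optimality is load-bearing in an HONEST way: `tautTwist8` — Grenet plus ONE parity vertex —
  is a pure, binary, dead-cell-free `8 × 8` projection of `per₃` in a second orbit (rank profile
  `1⁴2⁵`, max rank over the coefficient span 6 versus 5): the commutativity cancellation of `T`
  (paths `s→u₁→u₀→v→s` versus `s→u₂→u₀→v→s` read `X(1,0), X(2,0)` in opposite orders) becomes pure as
  soon as one spare vertex flips the parity of one of the two paths.  At size 7 there is no spare
  vertex: this is the mechanism any proof must exploit.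
* §D  structural picture (informal; written before the kill as "why it resists", kept because (i) is
  the reason the counterexample had to be a twist and (ii) is now known to be WRONG as a heuristic —
  the purified twist `K` has 7 constant `±1` cells off the diagonal pattern and still solves the system): (i) von zur Gathen/ABV codimension:
  `dim Sing V(per₃) ≤ 4 < 9 − codim{rank ≤ m−2}` ⇒ every `m × m` affine representation `M` of `per₃`
  has `rank M(x) ≥ m − 1` everywhere ⇒ `I_{m−1}(M) = (1)` ⇒ `coker M` is an invertible module on the
  normal cone `V(per₃)` ⇒ free ⇒ ALL affine representations are POLYNOMIAL-gauge twists
  `U(x)·G·V(x)` of Grenet (no second component of the affine moduli); (ii) equation counting in the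
  pure model: unknowns = 6 loop constants + #constant cells, equations ≥ 6 + #bad variable-multisets
  of closed walks; Grenet's skeleton is the unique tight case found; every commutativity cancellation
  at size 7 forces a `−1` relation among loop constants contradicting the six permutation equations
  (this is exactly what kills `T_c`, and it is NOT a general obstruction: `K` escapes it because its
  cancelling pair differs by a constant cell, i.e. by parity); (iii) the lead's T-purification request
  is closed negatively, the column-`v₀` purification (other seat) positively.
* Targets: none this cycle (`stuck_stubs = []`).

Evidence (session folder `compute/`, exact rational arithmetic, pure Python): `polys.py` (det by
Laplace-DP, rank profiles), `twist.py`/`t1.py` (Koszul twist zoo; `T`), `equiv.py` (exact-mod-p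
`GL×GL`-equivalence tester: `T ≁ G`, `T_c ≁ T_{c'}`, `T_c ~ T(γx)`), `eight.py` (`tautTwist8`,
`det = per₃` for loop constants `(p,p,p,q,q,q,1)`, `p²q² = 1`), `deadcells.py` (no dead cell in
`tautTwist8`, 14 in `G ⊕ 1`), `search8.py` (all 154 one-cell pure modifications of `G ⊕ 1`).
-/

noncomputable section

set_option linter.dupNamespace false

namespace Summit.ValiantsHypothesis.ValiantsHypothesis.Cruxes.ProjOptimalUnique.Disproof

open MvPolynomial Matrix
open Literature.Computability.AlgebraicComplexity
open Summit.ValiantsHypothesis.ValiantsHypothesis.Theses.ProjectionRigidity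

/-! ## §A Load-bearing hypotheses (landed separately; restated here for the index) -/

/-- The crux with PURITY weakened to affineness (`IsAffineDetRepr`).  Identical to the landed
`Literature.Uncategorized.ProjOptimalUniqueWithoutPure` (relocated by the gate from p154300). -/
def ProjOptimalUniqueWithoutPure : Prop :=
  ∀ n ≥ 3, ∀ A B : Matrix (Fin (detProjectionComplexity (perPoly (Fin n) ℂ)))
      (Fin (detProjectionComplexity (perPoly (Fin n) ℂ))) (MvPolynomial (Fin n × Fin n) ℂ),
    IsAffineDetRepr (perPoly (Fin n) ℂ) A → IsAffineDetRepr (perPoly (Fin n) ℂ) B →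
    ∃ (P Q : GL (Fin (detProjectionComplexity (perPoly (Fin n) ℂ))) ℂ) (γ : GL (Fin n × Fin n) ℂ),
      γ ∈ permSymmetrySubst ℂ n ∧
      (B = (P : Matrix _ _ ℂ).map MvPolynomial.C * Matrix.linSubstEntries γ A *
          (Q : Matrix _ _ ℂ).map MvPolynomial.C ∨
       B = (P : Matrix _ _ ℂ).map MvPolynomial.C * (Matrix.linSubstEntries γ A).transpose *
          (Q : Matrix _ _ ℂ).map MvPolynomial.C)

/-- **Any proof must use purity**: the affine weakening is false (`n = 3`: `pdc(per₃) = 7` makes it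
`GrenetRigidity.OptimalUniqueThree`, refuted in the tree by the Koszul twist with two-variable
cells).  Landed: `Theorems/ProjOptimalUnique/Negative/WithoutPure.lean`. -/
theorem projOptimalUnique_false_without_pure : ¬ ProjOptimalUniqueWithoutPure := by
  intro h
  have h3 := h 3 le_rfl
  revert h3
  rw [detProjectionComplexity_perPoly_three]
  exact Summit.ValiantsHypothesis.Theorems.GrenetRigidityOptimalUniqueThree_refuted

/-- The crux with OPTIMALITY dropped: pure uniqueness claimed at every size `m`. -/
def ProjOptimalUniqueWithoutOptimality : Prop :=
  ∀ n ≥ 3, ∀ m : ℕ, ∀ A B : Matrix (Fin m) (Fin m) (MvPolynomial (Fin n × Fin n) ℂ),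
    (∀ i j, (∃ v, A i j = MvPolynomial.X v) ∨ ∃ c, A i j = MvPolynomial.C c) →
    (∀ i j, (∃ v, B i j = MvPolynomial.X v) ∨ ∃ c, B i j = MvPolynomial.C c) →
    A.det = perPoly (Fin n) ℂ → B.det = perPoly (Fin n) ℂ →
    ∃ (P Q : GL (Fin m) ℂ) (γ : GL (Fin n × Fin n) ℂ), γ ∈ permSymmetrySubst ℂ n ∧
      (B = (P : Matrix _ _ ℂ).map MvPolynomial.C * Matrix.linSubstEntries γ A *
          (Q : Matrix _ _ ℂ).map MvPolynomial.C ∨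
       B = (P : Matrix _ _ ℂ).map MvPolynomial.C * (Matrix.linSubstEntries γ A).transpose *
          (Q : Matrix _ _ ℂ).map MvPolynomial.C)

/-- **Any proof must use `m = pdc(per_n)`**: false at `n = 3`, `m = 8`.  Witnesses `A₈ = G ⊕ 1`,
`B₈ = A₈` with the dead cell `(s, z) := X(2,1)` (rank of the `X(2,1)`-coefficient matrix 3 vs ≤ 2).
PROVED sorry-free in `Theorems/ProjOptimalUnique/Negative/WithoutOptimality.lean` (p154831, 398
lines); the `sorry` here only avoids duplicating that file before it is importable. -/
theorem projOptimalUnique_false_without_optimality : ¬ ProjOptimalUniqueWithoutOptimality := by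
  sorry

/-! ## §B The toric strengthening is false at size 7, and the toric witness is not purifiable -/

/-- Grenet's `7 × 7` matrix of `per₃` in the tree's convention (rows/cols `s,u₀,u₁,u₂,v₀,v₁,v₂`;
`per₃ = ∑_σ ∏_c X(σ c, c)`), verbatim `gA` of `GrenetRigidityOptimalUniqueThree_refuted`. -/
def grenet7 : Matrix (Fin 7) (Fin 7) (MvPolynomial (Fin 3 × Fin 3) ℂ) :=
  !![0, X (0,0), X (1,0), X (2,0), 0, 0, 0;
     0, 1, 0, 0, 0, X (2,1), X (1,1);
     0, 0, 1, 0, X (2,1), 0, X (0,1);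
     0, 0, 0, 1, X (1,1), X (0,1), 0;
     X (0,2), 0, 0, 0, 1, 0, 0;
     X (1,2), 0, 0, 0, 0, 1, 0;
     X (2,2), 0, 0, 0, 0, 0, 1]

/-- **The toric witness `T`** (reconstruction of the lead's `TORIC-T`, which is not mounted in the
disprover's jail): `T = G · (1 + D)`, `D = d · e_{u₀}ᵀ`, `d = (0, 0, X(2,0), −X(1,0), 0, 0, 0)ᵀ` the
third basic Koszul syzygy of row `s` — a SIGNED projection (cells `(u₁,u₀) = X(2,0)`,
`(u₂,u₀) = −X(1,0)`), `det T = per₃`, rank profile `1⁴ 2⁵` (Grenet: `1⁶ 2³`).  As a branching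
program: arcs `u₁ → u₀` (`X(2,0)`) and `u₂ → u₀` (`−X(1,0)`); the two degree-4 walks
`s →X(1,0)→ u₁ →X(2,0)→ u₀ → v → s` and `s →X(2,0)→ u₂ →−X(1,0)→ u₀ → v → s` read the same variables in
opposite orders and cancel — a COMMUTATIVITY cancellation, invisible to Nisan-type arguments. -/
def toricTwist : Matrix (Fin 7) (Fin 7) (MvPolynomial (Fin 3 × Fin 3) ℂ) :=
  !![0, X (0,0), X (1,0), X (2,0), 0, 0, 0;
     0, 1, 0, 0, 0, X (2,1), X (1,1);
     0, X (2,0), 1, 0, X (2,1), 0, X (0,1);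
     0, -X (1,0), 0, 1, X (1,1), X (0,1), 0;
     X (0,2), 0, 0, 0, 1, 0, 0;
     X (1,2), 0, 0, 0, 0, 1, 0;
     X (2,2), 0, 0, 0, 0, 0, 1]

/-- The unipotent (lower unitriangular) twist matrix `1 + D`. -/
def twistE : Matrix (Fin 7) (Fin 7) (MvPolynomial (Fin 3 × Fin 3) ℂ) :=
  !![1, 0, 0, 0, 0, 0, 0;
     0, 1, 0, 0, 0, 0, 0;
     0, X (2,0), 1, 0, 0, 0, 0;
     0, -X (1,0), 0, 1, 0, 0, 0;
     0, 0, 0, 0, 1, 0, 0;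
     0, 0, 0, 0, 0, 1, 0;
     0, 0, 0, 0, 0, 0, 1]

-- one inspection of 49 entries
set_option maxHeartbeats 800000 in
/-- `T = G · (1 + D)` and `1 + D` is lower unitriangular; every entry of `T` is `0`, `1`, `X w` or
`−X w` (a signed = toric projection with multipliers `±1`). -/
theorem toricTwist_eq_mul_and_shape : grenet7 * twistE = toricTwist ∧
    (∀ i j : Fin 7, i < j → twistE i j = 0) ∧ (∀ i : Fin 7, twistE i i = 1) ∧
    (∀ i j : Fin 7, toricTwist i j = 0 ∨ toricTwist i j = 1 ∨ ∃ w, toricTwist i j = X w ∨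
      toricTwist i j = -X w) := by
  refine ⟨Matrix.ext fun i j => ?_, fun i j hij => ?_, fun i => ?_, fun i j => ?_⟩
  · rw [grenet7, twistE, toricTwist]
    fin_cases i <;> fin_cases j <;> simp [Matrix.mul_apply, Fin.sum_univ_seven]
    all_goals ring
  · revert hij; rw [twistE]; fin_cases i <;> fin_cases j <;> simp
  · rw [twistE]; fin_cases i <;> rfl
  · rw [toricTwist]; fin_cases i <;> fin_cases j <;> simp

/-- `det T = det G`: the twist is unimodular. (`det G = per₃` is re-proved inside the landed negative
lemmas by the tree's unipotent factorisation; here we only record the reduction.) -/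
theorem det_toricTwist : toricTwist.det = grenet7.det := by
  obtain ⟨hmul, htri, hdiag, -⟩ := toricTwist_eq_mul_and_shape
  have hE : twistE.det = 1 := by
    rw [Matrix.det_of_lowerTriangular twistE htri, Fin.prod_univ_seven]
    simp [hdiag]
  rw [← hmul, Matrix.det_mul, hE, mul_one]

/-- The rank-profile separation, cheapest form: in `T` the variables `X(1,0)` and `X(2,0)` have
coefficient matrices with an invertible `2 × 2` minor (rank 2), whereas in `G` every variable of
row `s`/column `s` (six of them) has a rank-one coefficient matrix; under `B = P·G(γx)·Q` with `γ`
MONOMIAL (tree: every `γ ∈ permSymmetrySubst ℂ 3` is), rank profiles are preserved as multisets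
(the row map of `γ` is a bijection on the nine variables since `γ` is invertible).  Hence
`1⁴2⁵ ≠ 1⁶2³` separates.  Recorded here: the two minors. -/
theorem toricTwist_rankTwo_minors :
    ((Matrix.of fun i j => (toricTwist i j).coeff (Finsupp.single (2,0) 1)).submatrix
        ![(0 : Fin 7), 2] ![(3 : Fin 7), 1]).det = 1 ∧
    ((Matrix.of fun i j => (toricTwist i j).coeff (Finsupp.single (1,0) 1)).submatrix
        ![(0 : Fin 7), 3] ![(2 : Fin 7), 1]).det = -1 := by
  constructor <;> rw [toricTwist] <;>
    simp [Matrix.det_fin_two, MvPolynomial.coeff_X, Finsupp.single_left_inj]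

/-- NEAR-MISS (next negative lemma, plan fixed): **the toric strengthening of the crux is false at
the optimal size 7** — `T` and `G` are both toric projections of `per₃` of size `pdc(per₃)` and are
NOT `DetReprEquivalent (permSymmetrySubst ℂ 3)`.  Proof plan (all ingredients kernel-checked
elsewhere): monomiality of `γ` (tree refutation, copied in `Negative/WithoutOptimality.lean`),
injectivity of the row map of an invertible monomial matrix (`det_updateRow_add_smul_self` + zero
row), coefficient calculus `lin_v(P·G(γx)·Q) = c • P·lin_{w(v)} G·Q`, the six rank-one variables of
`G` versus the explicit `2 × 2` minors of the five rank-two variables of `T`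
(`toricTwist_rankTwo_minors` and the three middle ones), and `Fintype.card_le_of_injective`
(`6 ≤ 4`).  Obstruction to closing it in THIS file: only length (≈ 380 lines with the monomiality
block); it is being written as `Theorems/ProjOptimalUnique/Negative/NotToricUnique.lean`. -/
theorem toricTwist_not_detReprEquivalent :
    ¬ DetReprEquivalent (permSymmetrySubst ℂ 3) grenet7 toricTwist := by
  sorry

/-- NOT PURIFIABLE (answer to the lead's `disprover-wanted: purify T`): **no constant gauge image
`P·T_c·Q` of any member `T_c = G + c·(X(2,0)E(u₁,u₀) − X(1,0)E(u₂,u₀))` of the twist family is a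
pure projection** (and `T_c ~ T(γx)` for the torus `γ` with `d₀e₁e₂/e₀ = c`, so this covers the
whole crux-class of `T`, transposes included since `B` pure iff `Bᵀ` pure).
Hand proof (complete case analysis; exact, over `ℂ`): write `B = P T_c Q`, `p_k` = columns of
`P`, `q_l` = rows of `Q`.  Rank-one variables force `p_s = b·1_{R}`, `q_{u₀} = b⁻¹1_{C}`,
`p_{v_k} = a·1_{R_k}` (disjoint), `q_s = a⁻¹1_{C₀}`.  Purity of the `X(1,0)`- and `X(2,0)`-cells
`1_R(b q_{u₁})ᵀ − (c/b) p_{u₂} 1_Cᵀ`, `1_R (b q_{u₂})ᵀ + (c/b) p_{u₁} 1_Cᵀ` (0/1-valued, supports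
disjoint from `1_R 1_Cᵀ`) forces `p_{u₂} = (b/c)(κ1_R − g)`, `p_{u₁} = (b/c)(−μ1_R + g')` with
`g, g'` NON-ZERO disjoint 0/1 vectors off `R` (rank 2).  Then in the rows of `supp g'` the
`X(2,1)`-cell matrix is `h₄ᵀ` and the `X(1,1)`-cell matrix is `y_i h₄ᵀ` ⇒ `y_i = 0`, and the
`X(0,1)`-cell matrix is `zᵀ` ⇒ `z ∈ {0,1}⁷`; in the rows of `supp g` symmetrically `z ∈ {0,−1}⁷`;
so `z = 0`, i.e. the row `q_{v₂}` of `Q` vanishes — `Q` singular, contradiction.  With arbitrary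
per-variable multipliers `λ_v` the only escape is `λ(2,0)λ(1,1) / (λ(1,0)λ(0,1))·… = −1`, which no
rank-one (torus) `λ` achieves.  Formalisation deferred (finite but long case analysis); recorded as
a `Prop` so that planners can cite it. -/
def ToricTwistNotPurifiable : Prop :=
  ∀ (c : ℂ) (P Q : Matrix (Fin 7) (Fin 7) ℂ), IsUnit P.det → IsUnit Q.det →
    let Tc : Matrix (Fin 7) (Fin 7) (MvPolynomial (Fin 3 × Fin 3) ℂ) :=
      !![0, X (0,0), X (1,0), X (2,0), 0, 0, 0;
         0, 1, 0, 0, 0, X (2,1), X (1,1);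
         0, C c * X (2,0), 1, 0, X (2,1), 0, X (0,1);
         0, -(C c * X (1,0)), 0, 1, X (1,1), X (0,1), 0;
         X (0,2), 0, 0, 0, 1, 0, 0;
         X (1,2), 0, 0, 0, 0, 1, 0;
         X (2,2), 0, 0, 0, 0, 0, 1]
    let B : Matrix (Fin 7) (Fin 7) (MvPolynomial (Fin 3 × Fin 3) ℂ) :=
      P.map MvPolynomial.C * Tc * Q.map MvPolynomial.C
    ¬ ∀ i j, (∃ v, B i j = X v) ∨ ∃ d, B i j = MvPolynomial.C d

/-! ## §C Size `pdc + 1 = 8`: a TAUT second pure orbit (the parity vertex) -/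

/-- **`tautTwist8`**: Grenet `⊕` one vertex `z`, with the twist cell `(u₁, u₀) = X(2,0)` kept and
the signed cell `(u₂, u₀) = −X(1,0)` replaced by the detour `u₂ →1→ z →X(1,0)→ u₀` (cells
`(u₂, z) = 1`, `(z, u₀) = X(1,0)`).  Binary, pure, `det = per₃` (exact check, `compute/eight.py`;
more generally with loop constants `(p,p,p,q,q,q,1)`, `p²q² = 1`), rank profile `1⁴2⁵`, max rank
over the span of the coefficient matrices `6` (`G ⊕ 1`: `5`) ⇒ not in the orbit of `G ⊕ 1` under
`GL₈ × GL₈ × GL₉ × ᵀ`; and NO dead cell (all 64 cofactors are non-zero polynomials; `G ⊕ 1` has 14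
dead cells).  The cancelling pair of walks now has lengths 4 and 5, so opposite signs come from
parity and all variable coefficients are `+1`: purification costs exactly one vertex. -/
def tautTwist8 : Matrix (Fin 8) (Fin 8) (MvPolynomial (Fin 3 × Fin 3) ℂ) :=
  !![0, X (0,0), X (1,0), X (2,0), 0, 0, 0, 0;
     0, 1, 0, 0, 0, X (2,1), X (1,1), 0;
     0, X (2,0), 1, 0, X (2,1), 0, X (0,1), 0;
     0, 0, 0, 1, X (1,1), X (0,1), 0, 1;
     X (0,2), 0, 0, 0, 1, 0, 0, 0;
     X (1,2), 0, 0, 0, 0, 1, 0, 0;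
     X (2,2), 0, 0, 0, 0, 0, 1, 0;
     0, X (1,0), 0, 0, 0, 0, 0, 1]

/-- NEAR-MISS (Lean cost only): `det tautTwist8 = per₃`.  Checked exactly in `compute/eight.py`
(rational arithmetic, Laplace DP).  A Lean proof goes through `tautTwist8 · E₁ · E₂ · E₃ = U`
upper triangular (three unipotent factors: the Grenet ones and the parity column); omitted in this
cycle in favour of the landed `WithoutOptimality` witness, which already settles the size-8 claim. -/
theorem det_tautTwist8 : tautTwist8.det = perPoly (Fin 3) ℂ := by
  sorry

end Summit.ValiantsHypothesis.ValiantsHypothesis.Cruxes.ProjOptimalUnique.Disproof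

end
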